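import Literature.IUT.HodgeTheaters.GenuineFKitOfBadLocalRealified
import Literature.IUT.HodgeTheaters.GenuineFKitMergeInputs
import Literature.AlgebraicGeometry.Frobenioids.GroupSubfunctorModelRigidity
import HarnessLib

/-!
# R60 «M4-OVER-PHI»: the realified global side of the merge record keyed OVER `F_{Φ^rlf}` — the §0-automorphism classes of
# `𝒞⊩_mod` lying over its structure functor form the TRIVIAL group (abc-iut-L1-t3 ★ p496532), and `RealifiedGlobalSide.ofNumberFieldOverPhi`

S. Mochizuki, *Inter-universal Teichmüller theory I*, kurims manuscript (May 2020), Example 3.5 (i)(ii) pp. 84–86, Remark 3.5.2 p. 86 («an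
isomorphism … compatible with the … `ρ_v`»), Remark 5.2.1 (ii) p. 143 («by the rigidity of the divisor monoids»), Definition 5.2 (iv) (a)–(e)
pp. 134–135 ([IUTchI] Ex 3.5 (i) p.84) [claim: Mochizuki2012, status: disputed] (D-0012 claim key, series status DISPUTED — compositions BY NAME over
landed files; nothing of the series is asserted; no side is taken on [IUTchIII] Cor. 3.12).
S. Mochizuki, *The geometry of Frobenioids I*, Kyushu J. Math. **62** (2008), Prop. 5.3 p. 103, Thm. 6.4 (i) p. 114 [cite: MochizukiFrdI2008, Thm. 6.4 (i) p.114].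

PURPOSE (abc-iut-L5-lead RULINGS #120 (1)(b), row R60; abc-iut-L1-t3 FINDING F1–F4 04:55:02Z + abc-iut-L1-lead R177).  The bare one-object kind
`SingleObj (CatAut 𝒞⊩_mod)` of `GenuineFKitOfBadLocalRealified.lean` (★ p497530) is the (m4) NON-VACUITY inhabitant and nothing more: its
automorphism group contains the class of the Frobenius endofunctor `powFunctor 2` (★ p497753), so NO [IUTchI] Cor. 5.6 (i) reading may be booked
on it.  Print's isomorphisms of a `⊩`-collection `(‡𝒞^⊩, Prime(‡𝒞^⊩) ⥲ 𝕍, ‡𝔉^⊢, {‡ρ_v})` are COMPATIBLE SYSTEMS (Rmk. 3.5.2 / Rmk. 5.2.1 (ii)): a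
self-equivalence of `‡𝒞^⊩` enters only together with its action on `Φ_{‡𝒞^⊩}` — in OUR typing, it must LIE OVER the structure functor
`𝒞⊩_mod → F_{Φ^rlf}` (`(deg_Fr, Base, Div)`).  THIS FILE keys the (m4) slot that way:
* `CatIsomorphism.overIdSubgroup p : Subgroup (CatAut C)` — the §0-automorphism classes of `C` lying over the IDENTITY of `B` w.r.t. `p : C ⥤ B`
  (carrier `{c | LiesOverClass p c 1}` over abc-iut-L5-t16's `LiesOverClass` ★ p495677; bridge lemmas `mem_overIdSubgroup_iff`,
  `overIdSubgroup_eq_bot_iff_kernelRigid` — no second definition of B's predicates);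
* `rlfArithToElem L` — THE structure functor `𝒞_{L/L}^rlf → F_{Φ^rlf}` (abc-iut-L1 `PreFrobenioid.rlfToElem`, abbreviation);
* **`rigidOverBase_rlfArithToElem L : CatIsomorphism.RigidOverBase (rlfArithToElem L)`** and **`kernelRigid_rlfArithToElem`** — BY NAME from
  abc-iut-L1-t3 ★ p496532 `arithRlf_nonempty_iso_id_of_iso_over_toElem` (hypothesis-free at every number field); hence
  **`overIdSubgroup_rlfArithToElem_eq_bot`** and `subsingleton_overIdSubgroup_rlfArithToElem` — the group IS trivial;
* **`RealifiedGlobalSide.ofNumberFieldOverPhi L`** := ⟨`Glob := SingleObj ↥(overIdSubgroup (rlfArithToElem L))`, `gModel := ⋆`⟩ — the (m4) SLOT OF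
  RECORD for Cor. 5.6 (i)/(ii) / Ex. 5.4 (vi) readings (RULINGS #120 (1)(b)); `realifiedGlobalSideOfModuliOverPhi D` at `F_mod`;
  `subsingleton_end_gModel_ofNumberFieldOverPhi` (every endomorphism of the model in `Glob` is the identity);
* `MergeInputs.withM4 I m4'` (re-instantiation of the (m4) field of a merge record) and `MergeInputs.overPhi I := I.withM4 (…OverPhi)`.
BINDER CENSUS: none beyond `L` / `D` / `I`; FACT 0; no instance, no notation, no `sorry`.  HONEST: statements about OUR `𝒞⊩_mod` and OUR kit; the
Cor. 5.6 (i) row at the kit is NOT booked here (abc-iut-w5-d217's kit pattern + the referee decide); typed ≠ inhabited ≠ proved.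
-/

noncomputable section

namespace Literature.IUT.HodgeTheaters

open CategoryTheory Literature.AlgebraicGeometry.Frobenioids

universe v₁ v₂ u₁ u₂

/-! ### §0: automorphism classes over the identity of the base of a structure functor -/

namespace CatIsomorphism

variable {C : Type u₁} [Category.{v₁} C] {B : Type u₂} [Category.{v₂} B] (p : C ⥤ B)

/-- **The §0-automorphism classes of `C` lying over the identity of `B`** w.r.t. the structure functor `p : C ⥤ B` — a subgroup of `Aut(C)`
(closed under the group laws by abc-iut-L5-t16's `liesOverClass_one` / `LiesOverClass.mul` / `.inv`). ([IUTchI] Cor 5.3 p.144) [claim: Mochizuki2012, status: disputed] -/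
def overIdSubgroup : Subgroup (CatAut C) where
  carrier := {c | LiesOverClass p c 1}
  one_mem' := liesOverClass_one p
  mul_mem' {c} {c'} h h' := by
    have hm := LiesOverClass.mul h h'
    rwa [mul_one] at hm
  inv_mem' {c} h := by
    have hi := LiesOverClass.inv h
    rwa [inv_one] at hi

/-- Membership: `c ∈ overIdSubgroup p ↔ LiesOverClass p c 1` (bridge to abc-iut-L5-t16's predicate). ([IUTchI] Cor 5.3 p.144) [claim: Mochizuki2012, status: disputed] -/
theorem mem_overIdSubgroup_iff (c : CatAut C) : c ∈ overIdSubgroup p ↔ LiesOverClass p c 1 := Iff.rfl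

/-- `overIdSubgroup p = ⊥` IS `KernelRigid p` (bridge to abc-iut-L5-t16's predicate). ([IUTchI] Cor 5.3 p.144) [claim: Mochizuki2012, status: disputed] -/
theorem overIdSubgroup_eq_bot_iff_kernelRigid : overIdSubgroup p = ⊥ ↔ KernelRigid p := by
  rw [Subgroup.eq_bot_iff_forall]
  exact ⟨fun h c hc => h c hc, fun h c hc => h c hc⟩

end CatIsomorphism

/-! ### THE structure functor of `𝒞⊩_mod` and its rigidity (abc-iut-L1-t3 ★ p496532 by name) -/

/-- **`𝒞_{L/L}^rlf → F_{Φ^rlf}`**, THE structure functor `(deg_Fr, Base, Div)` of the realified arithmetic Frobenioid of a number field `L`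
(abc-iut-L1 `PreFrobenioid.rlfToElem`). [cite: MochizukiFrdI2008, Prop. 5.3 p.103] -/
abbrev rlfArithToElem (L : Type) [Field L] [NumberField L] :=
  PreFrobenioid.rlfToElem (ModelFrobenioid.toElem (arithDivisorFunctor L L) (unitsFunctor L L) (divNatTrans L L))
    (arith_objectwise_isPerfFactorial L L)

variable (L : Type) [Field L] [NumberField L]

/-- **`𝒞⊩_mod` is RIGID OVER `F_{Φ^rlf}`** in abc-iut-L5-t16's currency `RigidOverBase`: every self-equivalence of `𝒞_{L/L}^rlf` lying under the identity
of `F_{Φ^rlf}` is `≅ 𝟭` — abc-iut-L1-t3 ★ p496532 `arithRlf_nonempty_iso_id_of_iso_over_toElem` BY NAME (hypothesis-free).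
[cite: MochizukiFrdI2008, Thm. 6.4 (i) p.114] -/
theorem rigidOverBase_rlfArithToElem : CatIsomorphism.RigidOverBase (rlfArithToElem L) := by
  rintro Ψ ⟨h⟩
  exact arithRlf_nonempty_iso_id_of_iso_over_toElem L Ψ.functor (h ≪≫ (rlfArithToElem L).rightUnitor)

/-- **`𝒞⊩_mod` is kernel-rigid over `F_{Φ^rlf}`**: a §0-automorphism class of `𝒞_{L/L}^rlf` over the identity of `F_{Φ^rlf}` is the identity.
[cite: MochizukiFrdI2008, Thm. 6.4 (i) p.114] -/
theorem kernelRigid_rlfArithToElem : CatIsomorphism.KernelRigid (rlfArithToElem L) :=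
  CatIsomorphism.kernelRigid_iff_rigidOverBase.2 (rigidOverBase_rlfArithToElem L)

/-- **The §0-automorphism classes of `𝒞⊩_mod` over the identity of `F_{Φ^rlf}` form the TRIVIAL group.** [cite: MochizukiFrdI2008, Thm. 6.4 (i) p.114] -/
theorem overIdSubgroup_rlfArithToElem_eq_bot : CatIsomorphism.overIdSubgroup (rlfArithToElem L) = ⊥ :=
  (CatIsomorphism.overIdSubgroup_eq_bot_iff_kernelRigid _).2 (kernelRigid_rlfArithToElem L)

/-- … hence that group is a subsingleton. [cite: MochizukiFrdI2008, Thm. 6.4 (i) p.114] -/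
theorem subsingleton_overIdSubgroup_rlfArithToElem : Subsingleton ↥(CatIsomorphism.overIdSubgroup (rlfArithToElem L)) := by
  rw [overIdSubgroup_rlfArithToElem_eq_bot]
  exact Unique.instSubsingleton

namespace InitialThetaData

/-- **(m4) OVER `F_{Φ^rlf}` from a number field `L`** — the slot of record for [IUTchI] Cor. 5.6 (i)/(ii) / Ex. 5.4 (vi) readings (RULINGS #120 (1)(b)):
`Glob :=` the one-object kind of the §0-automorphism classes of `𝒞_{L/L}^rlf` LYING OVER its structure functor (print's compatible systems,
Rmk. 3.5.2 / Rmk. 5.2.1 (ii)), `gModel := ⋆`. ([IUTchI] Ex 3.5 (i) p.84) [claim: Mochizuki2012, status: disputed] -/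
def RealifiedGlobalSide.ofNumberFieldOverPhi : RealifiedGlobalSide where
  Glob := SingleObj ↥(CatIsomorphism.overIdSubgroup (rlfArithToElem L))
  gModel := SingleObj.star _

/-- Its global category is that one-object kind. ([IUTchI] Ex 3.5 (i) p.84) [claim: Mochizuki2012, status: disputed] -/
theorem RealifiedGlobalSide.ofNumberFieldOverPhi_Glob :
    (RealifiedGlobalSide.ofNumberFieldOverPhi L).Glob = SingleObj ↥(CatIsomorphism.overIdSubgroup (rlfArithToElem L)) := rfl

/-- **Rigidity of the (m4) slot of record: every endomorphism of the model `𝒞⊩_mod` in `Glob` is the identity** (the group is trivial,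
`overIdSubgroup_rlfArithToElem_eq_bot`) — the honest reason is rigidity OVER `F_Φ` (abc-iut-L1-t3 ★ p496532), not bare-category rigidity
(refuted by `powFunctor 2`, ★ p497753). ([IUTchI] Rmk 5.2.1 (ii) p.143) [claim: Mochizuki2012, status: disputed] -/
theorem subsingleton_end_gModel_ofNumberFieldOverPhi :
    letI := (RealifiedGlobalSide.ofNumberFieldOverPhi L).cat
    Subsingleton ((RealifiedGlobalSide.ofNumberFieldOverPhi L).gModel ⟶ (RealifiedGlobalSide.ofNumberFieldOverPhi L).gModel) :=
  subsingleton_overIdSubgroup_rlfArithToElem L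

variable {F K Fbar : Type} [Field F] [NumberField F] [Field K] [NumberField K] [Algebra F K]
  [Field Fbar] [Algebra F Fbar] [Algebra K Fbar] {E : WeierstrassCurve F}
  [E.IsElliptic] {l : ℕ} {Pb : BadPlacePredicates K}

/-- **(m4) OVER `F_{Φ^rlf}` OF THE INITIAL Θ-DATA**: `𝒞⊩_mod` of the field of moduli `F_mod`, keyed over its structure functor.
([IUTchI] Ex 3.5 (i) p.84) [claim: Mochizuki2012, status: disputed] -/
def realifiedGlobalSideOfModuliOverPhi (_D : InitialThetaData F K Fbar E l Pb) : RealifiedGlobalSide :=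
  RealifiedGlobalSide.ofNumberFieldOverPhi (fieldOfModuli E)

variable {D : InitialThetaData F K Fbar E l Pb} {B : ∀ v, v ∈ D.indexCopyBad → D.BadPairAt v}

/-- Re-instantiation of the (m4) field of a merge record. ([IUTchI] Def 5.2 (iv) p.134) [claim: Mochizuki2012, status: disputed] -/
def MergeInputs.withM4 (I : D.MergeInputs B) (m4' : RealifiedGlobalSide) : D.MergeInputs B where
  m2 := I.m2
  m1 := I.m1
  m4 := m4'
  geomTFG := I.geomTFG

/-- **The merge record with its (m4) keyed OVER `F_{Φ^rlf}`** (the slot of record for the `⊩`-side readings).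
([IUTchI] Def 5.2 (iv) p.134) [claim: Mochizuki2012, status: disputed] -/
def MergeInputs.overPhi (I : D.MergeInputs B) : D.MergeInputs B := I.withM4 D.realifiedGlobalSideOfModuliOverPhi

/-- Its (m4) IS `realifiedGlobalSideOfModuliOverPhi`; its other fields are those of `I`. ([IUTchI] Def 5.2 (iv) p.134) [claim: Mochizuki2012, status: disputed] -/
theorem MergeInputs.overPhi_fields (I : D.MergeInputs B) :
    I.overPhi.m4 = D.realifiedGlobalSideOfModuliOverPhi ∧ I.overPhi.m2 = I.m2 ∧ I.overPhi.geomTFG = I.geomTFG := ⟨rfl, rfl, rfl⟩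

end InitialThetaData

end Literature.IUT.HodgeTheaters

end
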